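import Mathlib
import Literature.Computability.AlgebraicComplexity.OrbitClosureProofs
import Summits.ValiantsHypothesis.ValiantsHypothesis.Theses.ValuativeGCT
import Summits.ValiantsHypothesis.ValiantsHypothesis.Theorems.ValuativeGCTValuativeFlipPencilTransferCore

/-!
# Four-row pencil transfer `m → m + 1` for the padded permanent (wall-breaker axis k8)

Crux `ValuativeGCT.ValuativeFlip` (stmt-ValiantsHypothesis-12624), line `four-row-count`, stub
`stub_fourRowPencilRank`.  The four-row tangent span of `g · X₀₀^{m-n} per_n` at size `m` embeds,
after one more unit of padding, into the four-row tangent span of a suitable `g' · X₀₀^{m+1-n} per_n`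
at size `m + 1` (`fourRowSpan_finrank_le_succ`), so the four-row tangent rank is monotone in `m`
for fixed `n` (`fourRowSpan_rank_mono`), and the pencil stub on the whole linear head
`n ≤ m ≤ 6n/5` reduces to its padding-free base size `m = n` (`fourRowPencilRank_of_base`).
No definitions are introduced (the index shift `(a, b) ↦ (a+1, b+1)` is written inline).
-/

set_option linter.dupNamespace false

namespace Summit.ValiantsHypothesis.ValiantsHypothesis.Theorems.ValuativeFlip

open MvPolynomial
open scoped BigOperators Matrix
open Literature.NumberTheory.DiophantineGeometry
open Literature.Computability.AlgebraicComplexity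

noncomputable section

/- The index shift `Fin m × Fin m → Fin (m+1) × Fin (m+1)`, `(a, b) ↦ (a + 1, b + 1)`, except
that the padding position `(0, 0)` is kept in place when there is padding (`n < m`) (a notation,
so that this helper file introduces no definitions). -/
set_option quotPrecheck false in
local notation "jF[" n ", " m "]" => (fun z : Fin m × Fin m =>
  (if n < m ∧ z = (0, 0) then ((0 : Fin (m + 1)), (0 : Fin (m + 1)))
    else (Fin.succ z.1, Fin.succ z.2) : Fin (m + 1) × Fin (m + 1)))

/-! ## Lexicographic bookkeeping: the kept (last four) positions -/

/-- The lexicographic index of the matrix position `(a, b)` is `b + m·a`. [folklore] -/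
theorem pt_matIdxEquiv_symm_toLex (m : ℕ) (a b : Fin m) :
    (((matIdxEquiv m).symm (toLex (a, b)) : Fin (m * m)) : ℕ) = (b : ℕ) + m * (a : ℕ) := by
  have h : toLex (a, b) = matIdxEquiv m (finProdFinEquiv (a, b)) := by
    rw [matIdxEquiv_apply, Equiv.symm_apply_apply]
  rw [h, OrderIso.symm_apply_apply]
  simp

/-- For `m ≥ 4` the kept positions (lexicographic index `≥ m² - 4`) are exactly the last four
entries of the last row. [folklore] -/
theorem pt_kept_iff {m : ℕ} (hm : 4 ≤ m) (a b : Fin m) :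
    m * m ≤ (((matIdxEquiv m).symm (toLex (a, b)) : Fin (m * m)) : ℕ) + 4 ↔
      (a : ℕ) + 1 = m ∧ m ≤ (b : ℕ) + 4 := by
  rw [pt_matIdxEquiv_symm_toLex]
  have ha := a.2
  have hb := b.2
  constructor
  · intro h
    by_contra hne
    rcases Nat.lt_or_ge ((a : ℕ) + 1) m with hlt | hge
    · have h2 : m * ((a : ℕ) + 2) ≤ m * m := Nat.mul_le_mul_left m (by omega)
      nlinarith
    · have haeq : (a : ℕ) + 1 = m := by omega
      have h3 : m * ((a : ℕ) + 1) = m * m := by rw [haeq]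
      have h4 : m * (a : ℕ) + m = m * m := by rw [← h3]; ring
      omega
  · rintro ⟨haeq, hbm⟩
    have h3 : m * ((a : ℕ) + 1) = m * m := by rw [haeq]
    have h4 : m * (a : ℕ) + m = m * m := by rw [← h3]; ring
    omega

/-- The index shift is injective. [folklore] -/
theorem pt_jF_injective (n m : ℕ) [NeZero m] : Function.Injective (jF[n, m]) := by
  intro z w h
  simp only at h
  by_cases hz : n < m ∧ z = (0, 0) <;> by_cases hw : n < m ∧ w = (0, 0)
  · exact hz.2.trans hw.2.symm
  · rw [if_pos hz, if_neg hw] at h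
    exact absurd (congrArg Prod.fst h).symm (Fin.succ_ne_zero _)
  · rw [if_neg hz, if_pos hw] at h
    exact absurd (congrArg Prod.fst h) (Fin.succ_ne_zero _)
  · rw [if_neg hz, if_neg hw] at h
    exact Prod.ext (Fin.succ_injective _ (congrArg Prod.fst h))
      (Fin.succ_injective _ (congrArg Prod.snd h))

/-- On block positions the index shift is `(a, b) ↦ (a + 1, b + 1)`. [folklore] -/
theorem pt_jF_block (n m : ℕ) [NeZero m] (x : BlockIdx n m × BlockIdx n m) :
    (jF[n, m]) ((x.1 : Fin m), (x.2 : Fin m)) = (Fin.succ (x.1 : Fin m), Fin.succ (x.2 : Fin m)) := by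
  simp only
  by_cases hnm : n < m
  · rw [if_neg]
    rintro ⟨-, h⟩
    exact paddedPerPoly_blockEmb_ne_zero n m (Nat.sub_pos_of_lt hnm) x h
  · rw [if_neg (fun h => hnm h.1)]

/-- For `m ≥ 4` the index shift carries kept positions exactly onto kept positions. [folklore] -/
theorem pt_kept_jF_iff (n m : ℕ) [NeZero m] (hm : 4 ≤ m) (z : Fin m × Fin m) :
    m * m ≤ (((matIdxEquiv m).symm (toLex z) : Fin (m * m)) : ℕ) + 4 ↔
      (m + 1) * (m + 1) ≤ (((matIdxEquiv (m + 1)).symm (toLex ((jF[n, m]) z)) :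
        Fin ((m + 1) * (m + 1))) : ℕ) + 4 := by
  obtain ⟨a, b⟩ := z
  simp only
  by_cases h0 : n < m ∧ (a, b) = (0, 0)
  · rw [if_pos h0, pt_kept_iff hm, pt_kept_iff (by omega : 4 ≤ m + 1)]
    have ha : a = 0 := congrArg Prod.fst h0.2
    subst ha
    simp only [Fin.val_zero, zero_add]
    omega
  · rw [if_neg h0, pt_kept_iff hm, pt_kept_iff (by omega : 4 ≤ m + 1)]
    simp only [Fin.val_succ]
    omega

/-- The padding position `(0, 0)` is not kept (for `m ≥ 4`). [folklore] -/
theorem pt_not_kept_zero (m : ℕ) [NeZero m] (hm : 4 ≤ m) :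
    ¬ (m * m ≤ (((matIdxEquiv m).symm (toLex ((0 : Fin m), (0 : Fin m))) : Fin (m * m)) : ℕ) + 4) := by
  rw [pt_kept_iff hm]
  simp only [Fin.val_zero, zero_add]
  omega

/-- There are two distinct kept positions (for `m ≥ 4`). [folklore] -/
theorem pt_kept_two (m : ℕ) [NeZero m] (hm : 4 ≤ m) :
    ∃ a₁ a₂ : MatIdx m, m * m ≤ (((matIdxEquiv m).symm a₁ : Fin (m * m)) : ℕ) + 4 ∧
      m * m ≤ (((matIdxEquiv m).symm a₂ : Fin (m * m)) : ℕ) + 4 ∧ a₁ ≠ a₂ := by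
  refine ⟨toLex ((⟨m - 1, by omega⟩ : Fin m), (⟨m - 1, by omega⟩ : Fin m)),
    toLex ((⟨m - 1, by omega⟩ : Fin m), (⟨m - 2, by omega⟩ : Fin m)), ?_, ?_, ?_⟩
  · rw [pt_kept_iff hm]; simp only; omega
  · rw [pt_kept_iff hm]; simp only; omega
  · intro h
    have h2 := congrArg (fun i : MatIdx m => ((ofLex i).2 : ℕ)) h
    simp only [ofLex_toLex] at h2
    omega

/-! ## The padded permanent at sizes `m` and `m + 1` -/

/-- `X₀₀^{m-n} per_n` in lexicographic variables, unfolded: `X ℓ₀ ^ (m - n) · P` with `P` the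
renamed block permanent. [Mulmuley–Sohoni 2001 §4; folklore] -/
theorem pt_paddedPerFormLex_eq (n m : ℕ) [NeZero m] :
    paddedPerFormLex ℂ n m = X (toLex ((0 : Fin m), (0 : Fin m))) ^ (m - n) *
      rename (fun ij : BlockIdx n m × BlockIdx n m => toLex ((ij.1 : Fin m), (ij.2 : Fin m)))
        (perPoly (BlockIdx n m) ℂ) := by
  rw [paddedPerFormLex, paddedPerPoly, map_mul, map_pow, rename_X, rename_rename]
  rfl

/-- The renamed block permanent at size `m + 1` is the index shift of the one at size `m`
(`n ≤ m`). [folklore] -/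
theorem pt_rename_blockPer_succ (n m : ℕ) [NeZero m] (hnm : n ≤ m) :
    rename (fun i : MatIdx m => toLex ((jF[n, m]) (ofLex i)))
      (rename (fun ij : BlockIdx n m × BlockIdx n m => toLex ((ij.1 : Fin m), (ij.2 : Fin m)))
        (perPoly (BlockIdx n m) ℂ)) =
      rename (fun ij : BlockIdx n (m + 1) × BlockIdx n (m + 1) =>
        toLex ((ij.1 : Fin (m + 1)), (ij.2 : Fin (m + 1)))) (perPoly (BlockIdx n (m + 1)) ℂ) := by
  let e : BlockIdx n m ≃ BlockIdx n (m + 1) :=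
    { toFun := fun i => ⟨Fin.succ (i : Fin m), by
        have := i.2; simp only [Fin.val_succ]; omega⟩
      invFun := fun i => ⟨⟨(i : Fin (m + 1)) - 1, by have := i.2; have := (i : Fin (m + 1)).2; omega⟩,
        by have := i.2; simp only; omega⟩
      left_inv := fun i => by
        apply Subtype.ext; apply Fin.ext; simp
      right_inv := fun i => by
        apply Subtype.ext; apply Fin.ext
        have := i.2
        have h1 : 1 ≤ ((i : Fin (m + 1)) : ℕ) := by omega
        simp only [Fin.val_succ]
        omega }
  have he : ∀ i : BlockIdx n m, ((e i : BlockIdx n (m + 1)) : Fin (m + 1)) = Fin.succ (i : Fin m) :=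
    fun i => rfl
  have hcomp : ((fun i : MatIdx m => toLex ((jF[n, m]) (ofLex i))) ∘
      (fun ij : BlockIdx n m × BlockIdx n m => toLex ((ij.1 : Fin m), (ij.2 : Fin m)))) =
      ((fun ij : BlockIdx n (m + 1) × BlockIdx n (m + 1) =>
        toLex ((ij.1 : Fin (m + 1)), (ij.2 : Fin (m + 1)))) ∘ Prod.map e e) := by
    funext x
    have hx := pt_jF_block n m x
    simp only [Function.comp_apply, ofLex_toLex, Prod.map_fst, Prod.map_snd, he]
    simp only at hx
    rw [hx]
  rw [rename_rename, ← rename_perPoly_equiv (k := ℂ) e, rename_rename, hcomp]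

/-- **One more unit of padding.** `X₀₀^{m+1-n} per_n` at size `m + 1` is
`X ℓ₀' ^ ((m - n) + 1)` times the index shift of the renamed block permanent of size `m`
(`n ≤ m`). [folklore] -/
theorem pt_paddedPerFormLex_succ (n m : ℕ) [NeZero m] (hnm : n ≤ m) :
    paddedPerFormLex ℂ n (m + 1) = X (toLex ((0 : Fin (m + 1)), (0 : Fin (m + 1)))) ^ (m - n + 1) *
      rename (fun i : MatIdx m => toLex ((jF[n, m]) (ofLex i)))
        (rename (fun ij : BlockIdx n m × BlockIdx n m => toLex ((ij.1 : Fin m), (ij.2 : Fin m)))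
          (perPoly (BlockIdx n m) ℂ)) := by
  rw [pt_paddedPerFormLex_eq, pt_rename_blockPer_succ n m hnm]
  congr 2
  exact Nat.sub_add_comm hnm

/-! ## The transfer for the padded permanent, its iteration, and the reduction of the stub -/

/-- **Transfer `m → m + 1` (representation-stability of the four-row tangent rank).**  For
`n ≤ m`, `m ≥ 4` and every `g ∈ GL_{m²}` there is `g' ∈ GL_{(m+1)²}` such that the four-row
tangent span of `g' · X₀₀^{m+1-n} per_n` (size `m + 1`) has dimension at least that of the
four-row tangent span of `g · X₀₀^{m-n} per_n` (size `m`): in pencil terms both spans are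
`ℓ^{m-n-1} · (span{y_a per(M)} + ℓ · span{y_a Per_{ij}(M)})` for the same four-variable pencil
`(ℓ, M)`, up to one more factor `ℓ`.  `g'` is the block extension of `g` along the index shift
`(a, b) ↦ (a+1, b+1)`, corrected by a transvection when the kept part of `g · X₀₀` vanishes.
[this crux, line four-row-count, wall-breaker axis k8] -/
theorem fourRowTangentRank_le_succ (n m : ℕ) [NeZero m] (hnm : n ≤ m) (hm : 4 ≤ m)
    (g : GL (MatIdx m) ℂ) :
    ∃ g' : GL (MatIdx (m + 1)) ℂ,
      Module.finrank ℂ ↥(Submodule.span ℂ (Set.range fun ab : {a : MatIdx m // m * m ≤ (((matIdxEquiv m).symm a : Fin (m * m)) : ℕ) + 4} × MatIdx m => (MvPolynomial.X ab.1.1 : MvPolynomial (MatIdx m) ℂ) * MvPolynomial.aeval (fun i : MatIdx m => if m * m ≤ (((matIdxEquiv m).symm i : Fin (m * m)) : ℕ) + 4 then (MvPolynomial.X i : MvPolynomial (MatIdx m) ℂ) else 0) (MvPolynomial.pderiv ab.2 (linSubst (MatIdx m) ℂ ((g : GL (MatIdx m) ℂ) : Matrix (MatIdx m) (MatIdx m)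 ℂ) (paddedPerFormLex ℂ n m))))) ≤
        Module.finrank ℂ ↥(Submodule.span ℂ (Set.range fun ab : {a : MatIdx (m + 1) // (m + 1) * (m + 1) ≤ (((matIdxEquiv (m + 1)).symm a : Fin ((m + 1) * (m + 1))) : ℕ) + 4} × MatIdx (m + 1) => (MvPolynomial.X ab.1.1 : MvPolynomial (MatIdx (m + 1)) ℂ) * MvPolynomial.aeval (fun i : MatIdx (m + 1) => if (m + 1) * (m + 1) ≤ (((matIdxEquiv (m + 1)).symm i : Fin ((m + 1) * (m + 1))) : ℕ) + 4 then (MvPolynomial.X i : MvPolynomial (MatIdx (m + 1)) ℂ) else 0) (MvPolynomial.pderiv ab.2 (linSubst (MatIdx (m + 1)) ℂ ((g' : GL (MatIdx (m + 1)) ℂ) : Matrix (MatIdx (m + 1)) (MatIdx (m + 1)) ℂ) (paddedPerFormLex ℂ n (m + 1)))))) := by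
  classical
  have hinj : Function.Injective (fun i : MatIdx m => toLex ((jF[n, m]) (ofLex i))) := by
    intro a b h
    have h2 := pt_jF_injective n m (toLex.injective h)
    exact ofLex.injective h2
  have hK : ∀ i : MatIdx m, m * m ≤ (((matIdxEquiv m).symm i : Fin (m * m)) : ℕ) + 4 ↔
      (m + 1) * (m + 1) ≤ (((matIdxEquiv (m + 1)).symm
        ((fun i : MatIdx m => toLex ((jF[n, m]) (ofLex i))) i) : Fin ((m + 1) * (m + 1))) : ℕ) + 4 := by
    intro i
    have h := pt_kept_jF_iff n m hm (ofLex i)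
    rwa [toLex_ofLex] at h
  have hφ : ∀ x : BlockIdx n m × BlockIdx n m,
      (fun i : MatIdx m => toLex ((jF[n, m]) (ofLex i)))
        ((fun ij : BlockIdx n m × BlockIdx n m => toLex ((ij.1 : Fin m), (ij.2 : Fin m))) x) ≠
      toLex ((0 : Fin (m + 1)), (0 : Fin (m + 1))) := by
    intro x h
    have hx := pt_jF_block n m x
    simp only [ofLex_toLex] at h hx
    rw [hx] at h
    exact Fin.succ_ne_zero _ (congrArg Prod.fst (toLex.injective h))
  have hjℓ : 0 < m - n → (fun i : MatIdx m => toLex ((jF[n, m]) (ofLex i)))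
      (toLex ((0 : Fin m), (0 : Fin m))) = toLex ((0 : Fin (m + 1)), (0 : Fin (m + 1))) := by
    intro hp
    have hlt : n < m := Nat.lt_of_sub_pos hp
    simp [hlt]
  have hjℓ' : m - n = 0 → ∀ i : MatIdx m, (fun i : MatIdx m => toLex ((jF[n, m]) (ofLex i))) i ≠
      toLex ((0 : Fin (m + 1)), (0 : Fin (m + 1))) := by
    intro hp i h
    simp only at h
    rw [if_neg (fun hh => absurd hh.1 (by omega))] at h
    exact Fin.succ_ne_zero _ (congrArg Prod.fst (toLex.injective h))
  obtain ⟨g', hg'⟩ := pt_transfer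
    (fun i : MatIdx m => m * m ≤ (((matIdxEquiv m).symm i : Fin (m * m)) : ℕ) + 4)
    (fun i : MatIdx (m + 1) => (m + 1) * (m + 1) ≤
      (((matIdxEquiv (m + 1)).symm i : Fin ((m + 1) * (m + 1))) : ℕ) + 4)
    (fun i : MatIdx m => toLex ((jF[n, m]) (ofLex i))) hinj hK (pt_kept_two (m + 1) (by omega))
    (fun ij : BlockIdx n m × BlockIdx n m => toLex ((ij.1 : Fin m), (ij.2 : Fin m)))
    (perPoly (BlockIdx n m) ℂ) (toLex ((0 : Fin m), (0 : Fin m)))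
    (toLex ((0 : Fin (m + 1)), (0 : Fin (m + 1)))) (m - n) (pt_not_kept_zero (m + 1) (by omega))
    hφ hjℓ hjℓ' g
  refine ⟨g', ?_⟩
  rw [pt_paddedPerFormLex_eq n m, pt_paddedPerFormLex_succ n m hnm]
  exact hg'

/-- **Monotonicity in `m`.**  For fixed `n`, a four-row tangent rank `≥ R` achieved at some base
size `m₀ ≥ max n 4` is achieved at every size `m ≥ m₀` (iterate `fourRowTangentRank_le_succ`).
[this crux, line four-row-count, wall-breaker axis k8] -/
theorem fourRowTangentRank_mono (n m₀ : ℕ) [NeZero m₀] (hn : n ≤ m₀) (hm₀ : 4 ≤ m₀) (R : ℕ)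
    (h : ∃ g : GL (MatIdx m₀) ℂ, R ≤ Module.finrank ℂ ↥(Submodule.span ℂ (Set.range fun ab : {a : MatIdx m₀ // m₀ * m₀ ≤ (((matIdxEquiv m₀).symm a : Fin (m₀ * m₀)) : ℕ) + 4} × MatIdx m₀ => (MvPolynomial.X ab.1.1 : MvPolynomial (MatIdx m₀) ℂ) * MvPolynomial.aeval (fun i : MatIdx m₀ => if m₀ * m₀ ≤ (((matIdxEquiv m₀).symm i : Fin (m₀ * m₀)) : ℕ) + 4 then (MvPolynomial.X i : MvPolynomial (MatIdx m₀) ℂ) else 0) (MvPolynomial.pderiv ab.2 (linSubst (MatIdx m₀) ℂ ((g : GL (MatIdx m₀) ℂ) : Matrix (MatIdx m₀) (MatIdx m₀) ℂ) (paddedPerFormLex ℂ n m₀)))))) :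
    ∀ (m : ℕ), m₀ ≤ m → ∀ [NeZero m], ∃ g : GL (MatIdx m) ℂ,
      R ≤ Module.finrank ℂ ↥(Submodule.span ℂ (Set.range fun ab : {a : MatIdx m // m * m ≤ (((matIdxEquiv m).symm a : Fin (m * m)) : ℕ) + 4} × MatIdx m => (MvPolynomial.X ab.1.1 : MvPolynomial (MatIdx m) ℂ) * MvPolynomial.aeval (fun i : MatIdx m => if m * m ≤ (((matIdxEquiv m).symm i : Fin (m * m)) : ℕ) + 4 then (MvPolynomial.X i : MvPolynomial (MatIdx m) ℂ) else 0) (MvPolynomial.pderiv ab.2 (linSubst (MatIdx m) ℂ ((g : GL (MatIdx m) ℂ) : Matrix (MatIdx m) (MatIdx m) ℂ) (paddedPerFormLex ℂ n m))))) := by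
  intro m hm
  induction m, hm using Nat.le_induction with
  | base => intro _; exact h
  | succ m hm ih =>
    intro _
    haveI : NeZero m := ⟨by omega⟩
    obtain ⟨g, hg⟩ := ih
    obtain ⟨g', hg'⟩ := fourRowTangentRank_le_succ n m (by omega) (by omega) g
    exact ⟨g', hg.trans hg'⟩

/-- **Reduction of `stub_fourRowPencilRank` to its padding-free base size.**  If for all large `n`
some `g ∈ GL_{n²}` gives the four-row tangent span of `g · per_n` (size `m = n`, no padding)
dimension at least `2·⌊6n/5⌋² + ⌊6n/5⌋ + 2`, then the pencil stub of line `four-row-count` holds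
on the whole linear head `n ≤ m ≤ 6n/5` (verbatim statement of `stub_fourRowPencilRank` in
`Cruxes/ValuativeFlip/Lines/four_row_count.lean`).  The base is the same combinatorial statement
about four-variable pencils `span{y_a Per_{ij}(M(y))}`, with the `m`-bookkeeping (padding
exponent, block embedding, size of the ambient matrix) removed.
[this crux, line four-row-count, wall-breaker axis k8] -/
theorem fourRowPencilRank_of_base
    (hbase : ∃ n₀ : ℕ, ∀ n ≥ n₀, ∀ [NeZero n], ∃ g : GL (MatIdx n) ℂ,
      2 * (6 * n / 5) ^ 2 + 6 * n / 5 + 2 ≤ Module.finrank ℂ ↥(Submodule.span ℂ (Set.range fun ab : {a : MatIdx n // n * n ≤ (((matIdxEquiv n).symm a : Fin (n * n)) : ℕ) + 4} × MatIdx n => (MvPolynomial.X ab.1.1 : MvPolynomial (MatIdx n) ℂ) * MvPolynomial.aeval (fun i : MatIdx n => if n * n ≤ (((matIdxEquiv n).symm i : Fin (n * n)) : ℕ) + 4 then (MvPolynomial.X i : MvPolynomial (MatIdx n) ℂ) else 0) (MvPolynomial.pderiv ab.2 (linSubst (MatIdx n) ℂ ((g : GL (MatIdx n) ℂ) : Matrix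 (MatIdx n) (MatIdx n) ℂ) (paddedPerFormLex ℂ n n)))))) :
    ∃ n₀ : ℕ, ∀ n ≥ n₀, ∀ (m : ℕ) [NeZero m], n ≤ m → 5 * m ≤ 6 * n →
      ∃ g : GL (MatIdx m) ℂ, 2 * m ^ 2 + m + 2 ≤ Module.finrank ℂ ↥(Submodule.span ℂ (Set.range fun ab : {a : MatIdx m // m * m ≤ (((matIdxEquiv m).symm a : Fin (m * m)) : ℕ) + 4} × MatIdx m => (MvPolynomial.X ab.1.1 : MvPolynomial (MatIdx m) ℂ) * MvPolynomial.aeval (fun i : MatIdx m => if m * m ≤ (((matIdxEquiv m).symm i : Fin (m * m)) : ℕ) + 4 then (MvPolynomial.X i : MvPolynomial (MatIdx m) ℂ) else 0) (MvPolynomial.pderiv ab.2 (linSubst (MatIdx m) ℂ ((g : GL (MatIdx m) ℂ) : Matrix (MatIdx m) (MatIdx m) ℂ) (paddedPerFormLex ℂ n m))))) := by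
  obtain ⟨n₀, h⟩ := hbase
  refine ⟨max n₀ 4, fun n hn m _ hnm h56 => ?_⟩
  have hn₀ : n₀ ≤ n := le_of_max_le_left hn
  have hn4 : 4 ≤ n := le_of_max_le_right hn
  haveI : NeZero n := ⟨by omega⟩
  obtain ⟨g₀, hg₀⟩ := h n hn₀
  obtain ⟨g, hg⟩ := fourRowTangentRank_mono n n le_rfl hn4 _ ⟨g₀, hg₀⟩ m hnm
  refine ⟨g, le_trans ?_ hg⟩
  have hmq : m ≤ 6 * n / 5 := (Nat.le_div_iff_mul_le (by norm_num)).mpr (by omega)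
  exact add_le_add (add_le_add (Nat.mul_le_mul_left 2 (Nat.pow_le_pow_left hmq 2)) hmq) le_rfl

end

end Summit.ValiantsHypothesis.ValiantsHypothesis.Theorems.ValuativeFlip
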